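import Summits.QuantumFields.YangMills.Theorems.WeakCouplingHypercubicLimitRP.Negative.OddTorusSwapPairingLiminf
import Summits.QuantumFields.YangMills.Theorems.WeakCouplingHypercubicLimitRP.Negative.DiagRPOfPlaneLimits
import Summits.QuantumFields.YangMills.Theorems.DiagonalMirrorRPRTwistLettersDefs
import Summits.QuantumFields.YangMills.Theorems.DiagonalMirrorRPRCubePairing

/-!
# Crux `WeakCouplingHypercubicLimitRP` (stmt-QuantumFields-27398), line `Sketch` (v2, sha16 `97b02a6fc0a363ac`) —
NEGATIVE-side structure, generation 3 of the standing disprover `cdisprove-27398-1` (crux workfile `Cruxes/…/Disproof.lean` §8–§11):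
**the letters of both doors are junk-closed, and S6i's simplicity hypothesis is load-bearing**

The two suppliers of the registered stub D1′ `stub_oddTorusSwapPairingLiminf` (l.1650) now in `Theorems/` reduce the socket
`OddTorusSwapPairingLiminf r sch` to LETTERS: door B (`…PencilRigidityWeakCouplingHypercubicLimitRPDiagRPOfTwistLetters`, p827816/p828264)
to `TwistLetters r sch` (a `DiagonalSliceModel` with `OddTwistGap` and `DiagLukewarm`), door C
(`…PencilRigidityWeakCouplingHypercubicLimitRPOfCubeDecoupling`, p828702) to `AdmissibleCubeDecoupling r sch`.  A refutation of a
letter would kill its door (not D1′).  This file shows, definition-free and sorry-free, that NO letter can be refuted by scheme-level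
or junk-group reasoning — the same closure that protects D1′ itself (`oddTorusSwapPairingLiminf_of_subsingleton`, p828406):

* `twistLetters_of_subsingleton` : at every one-element gauge group, every `LatticeRep`, every scheme, `TwistLetters r sch` holds —
  witnessed by the rank-one VACUUM slice model (even sector one mode of modulus `1`, odd sector empty, Gram weight = the Gram pairing,
  which is the perfect square `(famObs)²` there (`gramPairing_eq_sq_of_subsingleton`), depth `1`).
* `admissibleCubeDecoupling_of_subsingleton` : likewise `AdmissibleCubeDecoupling r sch` holds (free-cube and torus `n`-point
  functions coincide at a one-element group, `cubeLatticeSchwinger_eq_of_subsingleton`; radius `R = L`, admissible by `a_k L_k → ∞`).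
* `letters_jointly_satisfiable_at_punit` : at `(PUnit, punitRep, weakScheme)` ALL FIVE scheme-level binders of D1′/D1″
  (`HasWeakCouplingLimit`, `PolyVolume`, `PolyRenorm`, `UniformFunctionalBoundPlanes`, `∃ Δ > 0, RPSpectral`), BOTH doors' letters
  and the socket hold simultaneously.
* `rpCoreDisjoint_false_without_simple` : by contrast the registered stub S6i `stub_rpCoreDisjoint` (l.1453) is FALSE once its
  hypothesis `IsCompactSimpleLieGroup G` is dropped: at a one-element (compact, non-simple) `G` the connected three-point combination of
  its non-Gaussianity floor vanishes identically at every step (`kappaThree_eq_zero_of_subsingleton`), for every `LatticeRep` and scheme,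
  while every OTHER conjunct of S6i holds there (`letters_jointly_satisfiable_at_punit`).  So the `κ₃` floor is the unique
  group-sensitive conjunct of the whole line at the junk group, and any proof of S6i must use the non-triviality of `G`.

HONEST REGISTER: nothing here bears on the Yang–Mills mass gap; these are bookkeeping facts about the statements of two stubs and
their letters.  References: Osterwalder–Seiler, Ann. Phys. 110 (1978) §2; crux workfile `Disproof.lean` (census v3).
-/

set_option autoImplicit false

noncomputable section

open scoped SchwartzMap
open MeasureTheory Filter Topology
open Literature.MathematicalPhysics.AQFT Literature.MathematicalPhysics.QuantumLattice
open Literature.MathematicalPhysics.QuantumFieldTheory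
open Literature.Probability.LatticeModels (box Site)
open Summit.QuantumFields.YangMills.Cruxes.HypercubicLimit.CouplingResponse
open Summit.QuantumFields.YangMills.Cruxes.DiagonalMirrorRPR.ParityBridgeColdTraces (E4)
open Summit.QuantumFields.YangMills.Cruxes.DiagonalMirrorRPR.SignTwistedDiagonalTrace
open Summit.QuantumFields.YangMills.Cruxes.DiagonalMirrorRPR.CubeSurgery
open Summit.QuantumFields.YangMills.Theorems.WeakCouplingHypercubicLimitRP.Negative.OddTorusSwapPairingLiminf
  (latticeSchwinger_of_subsingleton swapPairing_eq_sq_of_subsingleton oddTorusSwapPairingLiminf_of_subsingleton)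
open Summit.QuantumFields.YangMills.Theorems.WeakCouplingHypercubicLimitRP.Negative.DiagRPOfPlaneLimits
  (weakScheme hasWeakCouplingLimit_weakScheme polyVolume_weakScheme polyRenorm_weakScheme uniformFunctionalBoundPlanes_weakScheme
    rpSpectral_of_subsingleton)
open Summit.QuantumFields.YangMills.Theorems.HypercubicLimit.Negative (punitRep)

namespace Summit.QuantumFields.YangMills.Theorems.WeakCouplingHypercubicLimitRP.Negative.LettersJunkGroup

variable {G : Type} [Group G] [TopologicalSpace G] [IsTopologicalGroup G] [CompactSpace G]
  [MeasurableSpace G] [BorelSpace G]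

/-! ## §1 The Gram pairing at a one-element gauge group -/

/-- At a one-element gauge group the Gram pairing of a reflected family is the square of its observable (at any configuration). -/
theorem gramPairing_eq_sq_of_subsingleton [Subsingleton G] (r : LatticeRep G) (sch : SpeciesScheme (YMSpecies G))
    (F : ReflectedFamily) (k : ℕ) (V₀ : LGConfig 4 G) :
    gramPairing r sch F k = (famObs r sch F k V₀) ^ 2 := by
  unfold gramPairing famObs
  rw [swapPairing_eq_sq_of_subsingleton r sch k F.n F.c F.f F.σf F.mirror]
  congr 1
  refine Finset.sum_congr rfl fun i _ => ?_
  rw [latticeSchwinger_of_subsingleton r sch k _ _ V₀]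

/-- Hence the Gram pairing is non-negative at EVERY step (one-element gauge group). -/
theorem gramPairing_nonneg_of_subsingleton [Subsingleton G] (r : LatticeRep G) (sch : SpeciesScheme (YMSpecies G))
    (F : ReflectedFamily) (k : ℕ) : 0 ≤ gramPairing r sch F k := by
  rw [gramPairing_eq_sq_of_subsingleton r sch F k (fun _ => 1)]
  exact sq_nonneg _

/-- … and dominated by the square of any sup bound of the family observable. -/
theorem gramPairing_le_sq_of_subsingleton [Subsingleton G] (r : LatticeRep G) (sch : SpeciesScheme (YMSpecies G))
    (F : ReflectedFamily) (k : ℕ) {B : ℝ} (hB : ∀ V, |famObs r sch F k V| ≤ B) : gramPairing r sch F k ≤ B ^ 2 := by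
  rw [gramPairing_eq_sq_of_subsingleton r sch F k (fun _ => 1), ← sq_abs]
  exact pow_le_pow_left₀ (abs_nonneg _) (hB _) 2

/-! ## §2 Bookkeeping: Kronecker `tsum`s and the size of the torus -/

/-- `Σ' j, δ_{j0}^n · w_j = w_0` for a weight `w` vanishing off `0`. -/
theorem tsum_indicator_pow_mul (n : ℕ) (g : ℝ) :
    ∑' j : ℕ, (if j = 0 then (1 : ℝ) else 0) ^ n * (if j = 0 then g else 0) = g := by
  have h : (fun j : ℕ => (if j = 0 then (1 : ℝ) else 0) ^ n * (if j = 0 then g else 0)) =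
      fun j => if j = 0 then g else 0 := by
    funext j
    split_ifs with hj
    · rw [one_pow, one_mul]
    · rw [mul_zero]
  rw [h]
  exact tsum_ite_eq 0 (fun _ => g)

/-- `Σ' j, δ_{j0}^n = 1` for `n ≠ 0`. -/
theorem tsum_indicator_pow {n : ℕ} (hn : n ≠ 0) : ∑' j : ℕ, (if j = 0 then (1 : ℝ) else 0) ^ n = 1 := by
  have h : (fun j : ℕ => (if j = 0 then (1 : ℝ) else 0) ^ n) = fun j => if j = 0 then (1 : ℝ) else 0 := by
    funext j
    split_ifs
    · rw [one_pow]
    · rw [zero_pow hn]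
  rw [h]
  exact tsum_ite_eq 0 (fun _ => (1 : ℝ))

/-- `Σ' j, 0^n = 0` for `n ≠ 0`. -/
theorem tsum_zero_pow {n : ℕ} (hn : n ≠ 0) : ∑' _j : ℕ, (0 : ℝ) ^ n = 0 := by
  rw [zero_pow hn, tsum_zero]

omit [TopologicalSpace G] [IsTopologicalGroup G] [CompactSpace G] [BorelSpace G] in
/-- Eventually the torus has at least three diagonal slices (`L_k ≥ 1`, from `a_k L_k → ∞` and `a_k → 0`). -/
theorem eventually_three_le_side (sch : SpeciesScheme (YMSpecies G)) : ∀ᶠ k in atTop, 3 ≤ sch.side k := by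
  have h1 : ∀ᶠ k in atTop, (1 : ℝ) ≤ sch.a k * sch.L k := sch.tendsto_L.eventually_ge_atTop 1
  have ha1 : ∀ᶠ k in atTop, sch.a k ≤ 1 := sch.tendsto_a.eventually (eventually_le_nhds one_pos)
  filter_upwards [h1, ha1] with k hk hk1
  have hL : (1 : ℝ) ≤ sch.L k := by
    by_contra hlt
    rw [not_le] at hlt
    have : sch.a k * (sch.L k : ℝ) < 1 * 1 := mul_lt_mul' hk1 hlt (Nat.cast_nonneg _) one_pos
    linarith
  have hL' : 1 ≤ sch.L k := by exact_mod_cast hL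
  simp only [SpeciesScheme.side]
  omega

/-! ## §3 Door B: `TwistLetters` at a one-element gauge group (the rank-one vacuum slice model) -/

/-- **Door-B letters hold at every one-element gauge group** (every `LatticeRep`, every scheme): `TwistLetters r sch`, witnessed by the
rank-one vacuum slice model — even sector `sp k = δ₀` (the top, modulus `1`), odd sector `sm ≡ 0`, Gram weights `wp F k = δ₀ · gramPairing`,
`wm ≡ 0`, depth `1`; `OddTwistGap` with `μ = 1` (empty odd sector) and `DiagLukewarm` with `θ = 1/4`, `C = 1` (normalised heat trace `1`). -/
theorem twistLetters_of_subsingleton [Subsingleton G] (r : LatticeRep G) (sch : SpeciesScheme (YMSpecies G)) :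
    TwistLetters r sch := by
  refine ⟨{ sp := fun _ j => if j = 0 then 1 else 0
            sm := fun _ _ => 0
            top := fun _ => 1
            top_pos := fun _ => one_pos
            sp_nonneg := fun _ j => by
              split_ifs
              · exact zero_le_one
              · exact le_rfl
            sm_nonneg := fun _ _ => le_rfl
            sp_le := fun _ j => by
              split_ifs
              · exact le_rfl
              · exact zero_le_one
            sm_le := fun _ _ => zero_le_one
            top_attained := fun _ => ⟨0, Or.inl (if_pos rfl)⟩
            summable_sp := fun _ => by
              have h : (fun j : ℕ => (if j = 0 then (1 : ℝ) else 0) ^ 2) = fun j => if j = 0 then (1 : ℝ) else 0 := by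
                funext j; split_ifs <;> norm_num
              rw [h]
              exact (hasSum_ite_eq 0 1).summable
            summable_sm := fun _ => by
              simp only [ne_eq, OfNat.ofNat_ne_zero, not_false_eq_true, zero_pow]
              exact summable_zero
            trace_nonneg := fun _ m hm _ => by
              rw [tsum_zero_pow (by omega), tsum_indicator_pow (by omega)]
              exact zero_le_one
            trace_side_pos := fun k => by
              have hs : sch.side k ≠ 0 := Nat.succ_ne_zero _
              rw [tsum_zero_pow hs, tsum_indicator_pow hs]
              exact one_pos
            wp := fun F k j => if j = 0 then gramPairing r sch F k else 0
            wm := fun _ _ _ => 0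
            wp_nonneg := fun F k j => by
              split_ifs
              · exact gramPairing_nonneg_of_subsingleton r sch F k
              · exact le_rfl
            wm_nonneg := fun _ _ _ => le_rfl
            w_bdd := fun F k => ⟨gramPairing r sch F k, fun j => ⟨by
              split_ifs
              · exact le_rfl
              · exact gramPairing_nonneg_of_subsingleton r sch F k, gramPairing_nonneg_of_subsingleton r sch F k⟩⟩
            depth := fun _ _ => 1
            depth_le := fun _ => ⟨1, by
              filter_upwards [sch.tendsto_a.eventually (eventually_le_nhds one_pos)] with k hk
              simpa using hk⟩
            pairing_eq := fun F => by
              filter_upwards [eventually_three_le_side sch] with k hk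
              refine ⟨by omega, ?_⟩
              have hs : sch.side k ≠ 0 := Nat.succ_ne_zero _
              rw [tsum_zero_pow hs, tsum_indicator_pow hs, tsum_indicator_pow_mul]
              simp only [mul_zero, tsum_zero, sub_zero, mul_one]
            weight_dom := fun F => by
              refine Filter.Eventually.of_forall fun k t B hB => ?_
              rw [tsum_indicator_pow_mul]
              simp only [mul_zero, tsum_zero, add_zero]
              have h2 : 2 * t + 2 * 1 ≠ 0 := by omega
              rw [tsum_zero_pow h2, tsum_indicator_pow h2, add_zero, mul_one]
              exact gramPairing_le_sq_of_subsingleton r sch F k hB }, ?_, ?_⟩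
  · -- R1 `OddTwistGap`: the odd sector is empty.
    refine ⟨1, one_pos, Filter.Eventually.of_forall fun k j => ?_⟩
    show (0 : ℝ) ≤ Real.exp (-(1 * sch.a k)) * 1
    rw [mul_one]
    exact (Real.exp_pos _).le
  · -- R2 `DiagLukewarm`: the normalised heat trace is `1` at every depth `t ≥ 1`.
    refine ⟨1 / 4, by norm_num, by norm_num, 1, ?_⟩
    filter_upwards [eventually_three_le_side sch] with k hk t ht
    have ht1 : 1 ≤ t := by
      have h3 : (3 : ℝ) ≤ sch.side k := by exact_mod_cast hk
      have : (0 : ℝ) < t := lt_of_lt_of_le (by linarith) ht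
      exact_mod_cast this
    have h2t : 2 * t ≠ 0 := by omega
    show ∑' j : ℕ, ((if j = 0 then (1 : ℝ) else 0) / 1) ^ (2 * t) + ∑' _j : ℕ, ((0 : ℝ) / 1) ^ (2 * t) ≤ 1
    simp only [div_one]
    rw [tsum_indicator_pow h2t, tsum_zero_pow h2t, add_zero]

/-! ## §4 Door C: `AdmissibleCubeDecoupling` at a one-element gauge group -/

/-- At a one-element gauge group the free-cube `n`-point function equals the torus one (both measures are probability measures and the
integrand is the constant `∏ᵢ Φ(uᵢ)(V₀)`). -/
theorem cubeLatticeSchwinger_eq_of_subsingleton [Subsingleton G] (r : LatticeRep G) (sch : SpeciesScheme (YMSpecies G))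
    (R : ℕ → ℕ) (k n : ℕ) (u : Fin n → 𝓢(E4, ℝ)) :
    cubeLatticeSchwinger r.ρ sch R (fun s => s.F) k n (fun _ => r.curvature) u =
      latticeSchwinger r.ρ sch (fun s => s.F) k n (fun _ => r.curvature) u := by
  set V₀ : LGConfig 4 G := fun _ => 1
  rw [latticeSchwinger_of_subsingleton r sch k n u V₀]
  haveI := isProbabilityMeasure_cubeMeasure (G := G) r.ρ r.continuous (sch.β k) (sch.side k) (R k)
  unfold cubeLatticeSchwinger
  have hc : (fun U : GaugeConfig 4 (sch.side k) G => ∏ i, smearedLatticeField ((fun s : YMSpecies G => s.F)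
      ((fun _ : Fin n => r.curvature) i)) (box 4 (sch.L k)) (sch.a k) (sch.c ((fun _ : Fin n => r.curvature) i) k)
      (sch.m ((fun _ : Fin n => r.curvature) i) k) (u i) (torusLift (sch.side k) U)) =
      fun _ => ∏ i, smearedLatticeField r.curvature.F (box 4 (sch.L k)) (sch.a k) (sch.c r.curvature k)
        (sch.m r.curvature k) (u i) V₀ := by
    funext U
    exact Finset.prod_congr rfl fun i _ => by rw [Subsingleton.elim (torusLift (sch.side k) U) V₀]
  rw [hc, integral_const, smul_eq_mul, probReal_univ, one_mul]

/-- Hence the free-cube and torus Gram pairings coincide at every step (one-element gauge group). -/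
theorem cubeGramPairing_eq_of_subsingleton [Subsingleton G] (r : LatticeRep G) (sch : SpeciesScheme (YMSpecies G))
    (R : ℕ → ℕ) (F : ReflectedFamily) (k : ℕ) : cubeGramPairing r sch R F k = gramPairing r sch F k := by
  unfold cubeGramPairing gramPairing
  simp only [cubeLatticeSchwinger_eq_of_subsingleton]

/-- `CubeDecoupling r sch R` holds at every one-element gauge group, for EVERY radius sequence `R`. -/
theorem cubeDecoupling_of_subsingleton [Subsingleton G] (r : LatticeRep G) (sch : SpeciesScheme (YMSpecies G))
    (R : ℕ → ℕ) : CubeDecoupling r sch R := by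
  intro F _
  simp only [cubeGramPairing_eq_of_subsingleton, sub_self]
  exact tendsto_const_nhds

/-- **Door-C letter holds at every one-element gauge group**: `AdmissibleCubeDecoupling r sch`, with `R = L` (admissible by the scheme
axiom `a_k L_k → ∞`). -/
theorem admissibleCubeDecoupling_of_subsingleton [Subsingleton G] (r : LatticeRep G) (sch : SpeciesScheme (YMSpecies G)) :
    AdmissibleCubeDecoupling r sch :=
  ⟨sch.L, fun _ => le_rfl, sch.tendsto_L, cubeDecoupling_of_subsingleton r sch sch.L⟩

/-! ## §5 Joint satisfiability of every binder, both doors' letters and the socket at the junk group -/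

/-- **At `(PUnit, punitRep, weakScheme)` everything but S6i's `κ₃` floor holds at once**: the five scheme-level binders of D1′/D1″, the
door-B letters `TwistLetters`, the door-C letter `AdmissibleCubeDecoupling`, and the socket `OddTorusSwapPairingLiminf`.  (So no letter and
no binder combination is refutable by scheme-level / junk-group reasoning, and the bridges p827816/p828702 have jointly satisfiable
hypotheses.) -/
theorem letters_jointly_satisfiable_at_punit [MeasurableSpace PUnit] [BorelSpace PUnit] :
    ∃ (r : LatticeRep PUnit) (sch : SpeciesScheme (YMSpecies PUnit)),
      sch.HasWeakCouplingLimit ∧ PolyVolume sch ∧ PolyRenorm r sch ∧ UniformFunctionalBoundPlanes r sch ∧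
      (∃ Δ C : ℝ, 0 < Δ ∧ RPSpectral r sch Δ C) ∧
      TwistLetters r sch ∧ AdmissibleCubeDecoupling r sch ∧ OddTorusSwapPairingLiminf r sch :=
  ⟨punitRep, weakScheme _, hasWeakCouplingLimit_weakScheme _, polyVolume_weakScheme _, polyRenorm_weakScheme _,
    uniformFunctionalBoundPlanes_weakScheme _, ⟨1, 0, one_pos, rpSpectral_of_subsingleton _ _ 1⟩,
    twistLetters_of_subsingleton _ _, admissibleCubeDecoupling_of_subsingleton _ _, oddTorusSwapPairingLiminf_of_subsingleton _ _⟩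

/-! ## §6 S6i `stub_rpCoreDisjoint`: the simplicity hypothesis is load-bearing -/

/-- At a one-element gauge group the connected three-point combination of S6i's non-Gaussianity floor vanishes identically at every
step, for every `LatticeRep`, every scheme and all test functions (each `n`-point function is the product of its one-point functions,
`latticeSchwinger_of_subsingleton`). -/
theorem kappaThree_eq_zero_of_subsingleton [Subsingleton G] (r : LatticeRep G) (sch : SpeciesScheme (YMSpecies G))
    (f g h : 𝓢(E4, ℝ)) (k : ℕ) :
    latticeSchwinger r.ρ sch (fun s => s.F) k 3 (fun _ => r.curvature) ![f, g, h] -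
        latticeSchwinger r.ρ sch (fun s => s.F) k 1 (fun _ => r.curvature) ![f] *
          latticeSchwinger r.ρ sch (fun s => s.F) k 2 (fun _ => r.curvature) ![g, h] -
        latticeSchwinger r.ρ sch (fun s => s.F) k 1 (fun _ => r.curvature) ![g] *
          latticeSchwinger r.ρ sch (fun s => s.F) k 2 (fun _ => r.curvature) ![f, h] -
        latticeSchwinger r.ρ sch (fun s => s.F) k 1 (fun _ => r.curvature) ![h] *
          latticeSchwinger r.ρ sch (fun s => s.F) k 2 (fun _ => r.curvature) ![f, g] +
        2 * (latticeSchwinger r.ρ sch (fun s => s.F) k 1 (fun _ => r.curvature) ![f] *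
          latticeSchwinger r.ρ sch (fun s => s.F) k 1 (fun _ => r.curvature) ![g] *
          latticeSchwinger r.ρ sch (fun s => s.F) k 1 (fun _ => r.curvature) ![h]) = 0 := by
  simp only [latticeSchwinger_of_subsingleton r sch k _ _ (fun _ => (1 : G)), Fin.prod_univ_succ,
    Fin.prod_univ_zero, Matrix.cons_val_zero, Matrix.cons_val_succ, mul_one]
  ring

/-- **S6i without `IsCompactSimpleLieGroup G` is false.**  The statement of `stub_rpCoreDisjoint` with its one hypothesis dropped —
`∀ G` (compact topological group, Borel), `∃ r sch`, weak coupling ∧ `PolyVolume` ∧ `PolyRenorm` ∧ UFB ∧ (`∃ Δ > 0, RPSpectral`) ∧ a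
`κ₃` floor on pairwise disjoint test functions — fails at `G = PUnit`: whatever `r`, `sch`, `f`, `g`, `h`, the floored quantity is `|0|`
at every step (`kappaThree_eq_zero_of_subsingleton`), so no `δ > 0` is eventually below it.  Every other conjunct holds there
(`letters_jointly_satisfiable_at_punit`): the floor is the unique group-sensitive conjunct, and any proof of S6i must use that `G` is
non-trivial (it is: `IsCompactSimpleLieGroup` excludes `PUnit`, cf. `punit_connected_not_simple`). -/
theorem rpCoreDisjoint_false_without_simple :
    ¬ ∀ (G : Type) [Group G] [TopologicalSpace G] [IsTopologicalGroup G] [CompactSpace G]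
      [MeasurableSpace G] [BorelSpace G],
      ∃ (r : LatticeRep G) (sch : SpeciesScheme (YMSpecies G)),
        sch.HasWeakCouplingLimit ∧ PolyVolume sch ∧ PolyRenorm r sch ∧ UniformFunctionalBoundPlanes r sch ∧
        (∃ Δ C : ℝ, 0 < Δ ∧ RPSpectral r sch Δ C) ∧
        (∃ (f g h : 𝓢(EuclideanSpace ℝ (Fin 4), ℝ)) (δ : ℝ),
          Disjoint (tsupport f) (tsupport g) ∧ Disjoint (tsupport f) (tsupport h) ∧
          Disjoint (tsupport g) (tsupport h) ∧ 0 < δ ∧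
          ∀ᶠ k in atTop, δ ≤
            |latticeSchwinger r.ρ sch (fun s => s.F) k 3 (fun _ => r.curvature) ![f, g, h] -
              latticeSchwinger r.ρ sch (fun s => s.F) k 1 (fun _ => r.curvature) ![f] *
                latticeSchwinger r.ρ sch (fun s => s.F) k 2 (fun _ => r.curvature) ![g, h] -
              latticeSchwinger r.ρ sch (fun s => s.F) k 1 (fun _ => r.curvature) ![g] *
                latticeSchwinger r.ρ sch (fun s => s.F) k 2 (fun _ => r.curvature) ![f, h] -
              latticeSchwinger r.ρ sch (fun s => s.F) k 1 (fun _ => r.curvature) ![h] *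
                latticeSchwinger r.ρ sch (fun s => s.F) k 2 (fun _ => r.curvature) ![f, g] +
              2 * (latticeSchwinger r.ρ sch (fun s => s.F) k 1 (fun _ => r.curvature) ![f] *
                latticeSchwinger r.ρ sch (fun s => s.F) k 1 (fun _ => r.curvature) ![g] *
                latticeSchwinger r.ρ sch (fun s => s.F) k 1 (fun _ => r.curvature) ![h])|) := by
  intro h
  letI : MeasurableSpace PUnit := borel PUnit
  haveI : BorelSpace PUnit := ⟨rfl⟩
  obtain ⟨r, sch, -, -, -, -, -, f, g, h', δ, -, -, -, hδ, hev⟩ := h PUnit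
  obtain ⟨k, hk⟩ := hev.exists
  rw [kappaThree_eq_zero_of_subsingleton r sch f g h' k, abs_zero] at hk
  exact absurd hk (not_le.2 hδ)

end Summit.QuantumFields.YangMills.Theorems.WeakCouplingHypercubicLimitRP.Negative.LettersJunkGroup

end
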